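import Summits.AtomisticToContinuum.Crystallization.Theorems.FreeSplittingCertificatesStrictSplittingRuleP1TableWeights

/-!
# `StrictSplittingRule` (stmt-AtomisticToContinuum-12560): regrouping CELL-VERTEX sums into SITE sums (P1 interpolant object, part 26)

Route `FreeSplittingCertificates`, crux r3 `StrictSplittingRule` (H12⋆ = `stub_coreJointCoercive`), unit b2b-freesplit-B gen 22.
VALUE = the combinatorial engine of the DEMAND side (HOME FAR-LEMMA-SPEC §17 (e)), the vertex analogue of `tsum_mul_sum_slots_eq` (part 16):
summing a cell-vertex quantity `g(n, π, m)` (cube `n`, piece `π`, vertex `m`, located at the site `n + p1VertOff (p1Par n) π m`) over all cells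
equals summing, over SITES `q`, the contributions of the ≤ 8 cubes `q − o` cornering at `q` whose listed vertex is `q`:
`Σ'_n Σ_π Σ_m g(n,π,m) = Σ'_q Σ_{o ∈ p1Corners} Σ_π Σ_m [p1VertOff (p1Par (q−o)) π m = o]·g(q−o, π, m)` (**`tsum_cellVertex_eq_tsum_site`**, nonnegative
summable `g`).  With `g(n,π,m) = v_{n+o}ᵀ(∫_{cell}λ_mW)v_{n+o}` this turns the sum over cells of the per-cell inequalities of parts 24–25 into the
matched lattice bare form `Σ_q v_qᵀ(∫φ_qW)v_q` of the ledger site by site (`p1SiteBareW`).  NOT a proof of H12⋆, NOT summit progress.  [folklore]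
-/

noncomputable section

open Set Function Filter Topology
open scoped BigOperators

namespace Summit.AtomisticToContinuum.Crystallization.Theorems.StrictSplittingRuleBirth

/-- Vertex offsets are cube corners. -/
theorem p1VertOff_mem_p1Corners (b : Bool) (π : Fin 6) (m : Fin 4) : p1VertOff b π m ∈ p1Corners :=
  (mem_p1Corners_iff _).2 (p1VertOff_mem b π m)

/-- Inserting the corner of a vertex: only `o = p1VertOff …` survives. -/
theorem sum_ite_vertOff_eq {b : Bool} {π : Fin 6} {m : Fin 4} (f : ℤ × ℤ × ℤ → ℝ) :
    (∑ o ∈ p1Corners, if p1VertOff b π m = o then f o else 0) = f (p1VertOff b π m) := by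
  rw [Finset.sum_ite_eq p1Corners (p1VertOff b π m) f, if_pos (p1VertOff_mem_p1Corners b π m)]

/-- **Regrouping cell-vertex sums into site sums** (nonnegative summable `g`):
`Σ'_n Σ_π Σ_m g(n,π,m) = Σ'_q Σ_{o∈corners} Σ_π Σ_m [p1VertOff (p1Par (q−o)) π m = o]·g(q−o,π,m)`, and the site family is summable. -/
theorem tsum_cellVertex_eq_tsum_site {g : (ℤ × ℤ × ℤ) → Fin 6 → Fin 4 → ℝ} (hg0 : ∀ n π m, 0 ≤ g n π m)
    (hs : Summable fun n => ∑ π, ∑ m, g n π m) :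
    Summable (fun q => ∑ o ∈ p1Corners, ∑ π : Fin 6, ∑ m : Fin 4, if p1VertOff (p1Par (q - o)) π m = o then g (q - o) π m else 0) ∧
    ∑' n, ∑ π, ∑ m, g n π m =
      ∑' q, ∑ o ∈ p1Corners, ∑ π : Fin 6, ∑ m : Fin 4, if p1VertOff (p1Par (q - o)) π m = o then g (q - o) π m else 0 := by
  classical
  -- slice by corner
  set Φ : (ℤ × ℤ × ℤ) → (ℤ × ℤ × ℤ) → ℝ := fun o n => ∑ π : Fin 6, ∑ m : Fin 4, if p1VertOff (p1Par n) π m = o then g n π m else 0 with hΦ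
  have hΦ0 : ∀ o n, 0 ≤ Φ o n := fun o n =>
    Finset.sum_nonneg fun π _ => Finset.sum_nonneg fun m _ => by split_ifs <;> [exact hg0 _ _ _; exact le_rfl]
  have hslice : ∀ n, (∑ o ∈ p1Corners, Φ o n) = ∑ π, ∑ m, g n π m := by
    intro n
    simp only [hΦ]
    rw [Finset.sum_comm]
    refine Finset.sum_congr rfl fun π _ => ?_
    rw [Finset.sum_comm]
    refine Finset.sum_congr rfl fun m _ => ?_
    exact sum_ite_vertOff_eq (fun _ => g n π m)
  have hsum_o : ∀ o ∈ p1Corners, Summable (Φ o) := fun o ho =>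
    Summable.of_nonneg_of_le (hΦ0 o) (fun n => (Finset.single_le_sum (fun o' _ => hΦ0 o' n) ho).trans (hslice n).le) hs
  have step1 : ∑ o ∈ p1Corners, ∑' n, Φ o n = ∑' n, ∑ π, ∑ m, g n π m := by
    rw [← Summable.tsum_finsetSum fun o ho => hsum_o o ho]
    exact tsum_congr hslice
  have step2 : ∀ o, ∑' n, Φ o n = ∑' q, Φ o (q - o) := fun o => by
    have e := (Equiv.subRight o).tsum_eq (Φ o)
    simp only [Equiv.subRight_apply] at e
    exact e.symm
  have step4 : ∀ o ∈ p1Corners, Summable fun q => Φ o (q - o) := fun o ho => by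
    have e := (Equiv.subRight o).summable_iff (f := Φ o)
    simp only [Function.comp_def, Equiv.subRight_apply] at e
    exact e.2 (hsum_o o ho)
  have hsumR : Summable fun q => ∑ o ∈ p1Corners, Φ o (q - o) := summable_sum fun o ho => step4 o ho
  refine ⟨hsumR, ?_⟩
  calc ∑' n, ∑ π, ∑ m, g n π m = ∑ o ∈ p1Corners, ∑' n, Φ o n := step1.symm
    _ = ∑ o ∈ p1Corners, ∑' q, Φ o (q - o) := Finset.sum_congr rfl fun o _ => step2 o
    _ = ∑' q, ∑ o ∈ p1Corners, Φ o (q - o) := (Summable.tsum_finsetSum fun o ho => step4 o ho).symm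

end Summit.AtomisticToContinuum.Crystallization.Theorems.StrictSplittingRuleBirth
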